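import Literature.NumberTheory.EllipticCurves.CyclotomicIwasawaMainTheoremIrreducible
import HarnessLib

/-!
# Yan–Zhu 2026, Theorem 4.9 (first clause): the cyclotomic main theorem in `Λ ⊗ ℚ_p` at an ODD good
# ordinary prime with `ρ̄_{E,p}` irreducible

Source: Xiaojun Yan, Xiuwu Zhu, *Main conjectures for non-CM elliptic curves at good ordinary
primes*, J. Algebra 693 (2026), doi:10.1016/j.jalgebra.2026.01.016; read on the store text
`paper:arxiv-2412.20078` = arXiv **v2** (2025-01-03): §4.4, statement 4.8 and Theorem 4.9 (bib key
`YanZhu2024MainConjNonCM`, as in `YanZhu2026/PPartBSD.lean`).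

ARXIV-VERSION NOTE (2026-08-23; lit GEN 98 `HOME/b2b-bsdres-lit/g98/DRIFT-READS.md` §F1, GLUE seat
gen 12): the numbers and pages quoted in this file ("§4.4, p. 11", "Thm. 4.9", "Thm. 3.6", "4.8")
are arXiv v2's and were previously labelled "v4". In the CURRENT text arXiv v3 ≡ **v4** (2026-01-23,
the revision carrying the journal DOI) Theorem 4.9 is **Theorem 5.2** (§5.1, Conj. 5.1 = Mazur's
statement), Thm. 3.6 = Thm. 3.6, Thm. 4.7 = Thm. 4.7, Thm. 4.15 → Thm. 5.11; the statement vendored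
here is UNCHANGED IN CONTENT (v2 "if (Im) holds" → v4 "if condition (Im) holds"; lit GEN 98 diff
read: CLEARED, locator drift only).

HONEST FRAMING (cell `b2b-bsdres-*`): this statement file vendors ONE refereed theorem as a named
fact (`def … : Prop`, D-0014; nothing asserted, no `_holds`). Its use in the cell: the rational
cyclotomic Iwasawa main theorem at `p = 3` (class X10b = X9's shape at the prime `3`), where the
companion fact `burungale_castella_skinner_charIdeal_eq_padicLFunction` (Burungale–Castella–Skinner,
IMRN 2025, Thm. 1.1.2 (a)) is printed only for `p > 3`. The statement below is, binder for binder,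
that tree fact with `5 ≤ p` relaxed to `3 ≤ p` — which is exactly what Theorem 4.9 prints.

As printed (§4.4, p. 11 of arXiv v2; = §5.1, Thm. 5.2 of v4): "Let `E/ℚ` be an elliptic curve of
conductor `N`, `p > 2` a prime such that `E` has good ordinary reduction at `p`. Suppose that the residue representation
`ρ̄_E : G_ℚ → Aut(E[p])` is irreducible. [4.8 = Mazur's statement: `𝒳_{ℱ_ord}(E/ℚ_∞)` is
`Λ_ℚ`-torsion and `Char_{Λ_ℚ}(𝒳_{ℱ_ord}(E/ℚ_∞)) = (𝓛_p^{MSD}(E/ℚ))`.] … Theorem 4.9. `𝒳_{ℱ_ord}(E/ℚ_∞)` is `Λ_ℚ`-torsion and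
`Char_{Λ_ℚ}(𝒳_{ℱ_ord}(E/ℚ_∞)) ⊗ ℚ_p = (𝓛_p^{MSD}(E/ℚ))` in `Λ_ℚ ⊗ ℚ_p`. Moreover, if (Im) holds, we
have `Char_{Λ_ℚ}(𝒳_{ℱ_ord}(E/ℚ_∞)) = (𝓛_p^{MSD}(E/ℚ))` in `Λ_ℚ`." Here (§3.3, Theorem 3.6 (CGS))
`𝓛_p^{MSD}(E/ℚ) ∈ Λ_ℚ` is the Mazur–Swinnerton-Dyer `p`-adic `L`-function normalised by `Ω_E^+`
(`𝓛_p^{MSD}(E/ℚ)(1) = (1 - α_p⁻¹)² · L(E,1)/Ω_E^+`), and `𝒳_{ℱ_ord}(E/ℚ_∞)` is the Pontryagin dual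
of the ordinary (= `p^∞`-) Selmer group over the cyclotomic `ℤ_p`-extension (§2).

Cell flag (referee rulings R9.1/R10.1 on the companion Theorem 4.15, `YanZhu2026/PPartBSD.lean`,
applying verbatim to Theorem 4.9 from which 4.15 is deduced): `YZ26@3-BF-ERL-Ohta` — the
Beilinson–Flach equivalence Thm. 4.7 is printed "Similarly, as [BSTW] (see also [CGS])" with every
proof pointer to the preprint BSTW arXiv:2409.01350; at `p = 3` the `Λ`-adic explicit reciprocity /
Eichler–Shimura inputs are in print only for `p ≥ 5`. The statement is the REFEREED statement,
valid as printed at every `p > 2`; the flag concerns a proof-level input at `p = 3` and is not a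
claim that anything is false.

## References

* X. Yan, X. Zhu, J. Algebra 693 (2026); numbers as read in arXiv:2412.20078v2: §4.4 (4.8), Thm. 4.9;
  §3.3 Thm. 3.6 (= v4 / journal: §5.1 Conj. 5.1, Thm. 5.2; §3.3 Thm. 3.6 — ARXIV-VERSION NOTE).
* A. Burungale, F. Castella, C. Skinner, IMRN 2025 (arXiv:2405.00270v2), Thm. 1.1.2 (the `p > 3`
  companion, tree fact `burungale_castella_skinner_charIdeal_eq_padicLFunction`).
-/

noncomputable section

open scoped Classical

open WeierstrassCurve

namespace Literature.NumberTheory.EllipticCurves.YanZhu2026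

/-- **Yan–Zhu, J. Algebra (2026), Theorem 4.9, first clause — the cyclotomic Iwasawa main
theorem in `Λ ⊗ ℚ_p` at an odd good ordinary prime with `ρ̄_{E,p}` irreducible (PROVED in the
source; vendored as a named fact).** As printed (§4.4): "Let
`E/ℚ` be an elliptic curve of conductor `N`, `p > 2` a prime such that `E` has good ordinary
reduction at `p`. Suppose that the residue representation `ρ̄_E : G_ℚ → Aut(E[p])` is irreducible.
… Theorem 4.9. `𝒳_{ℱ_ord}(E/ℚ_∞)` is `Λ_ℚ`-torsion and
`Char_{Λ_ℚ}(𝒳_{ℱ_ord}(E/ℚ_∞)) ⊗ ℚ_p = (𝓛_p^{MSD}(E/ℚ))` in `Λ_ℚ ⊗ ℚ_p`."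
Transcription — binder for binder the tree fact `burungale_castella_skinner_charIdeal_eq_padicLFunction`
(BCS 2025 Thm. 1.1.2 (a), `p > 3`) with `5 ≤ p` relaxed to `3 ≤ p`: `W` a globally minimal model of
`E`; `p ≥ 3` (`hp`) of good (`hgood`) ordinary (`hord : p ∤ a_p`) reduction with `E[p]` irreducible
(`hirr`); the cyclotomic `ℤ_p`-extension `κ` with topological generator `γ` matching the cyclotomic
variable (`hκ`, `hγ`, `hγ'`, as in bsd.S20/S21); `f` the newform of `E` (`hf`); `D` any
Pontryagin-dual datum (`X = D.X = X(E/ℚ_∞)`, `Λ = ℤ_p⟦T⟧`). Conclusion: (1) `X` is `Λ`-torsion;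
(2) there are `g ∈ Λ` and `k ∈ ℤ` with `char_Λ X = (g)` and `ι g = p^k · L_p(f, α)`
(`α = unitRoot W p`; equality of the principal ideals of `Λ[1/p]` generated by a generator of
`char_Λ X` and by `L_p`; the units of `Λ[1/p]` are `p^ℤ · Λˣ`). The source's `𝓛_p^{MSD}` is
normalised by the Néron period `Ω_E^+`, i.e. equals `ϖ · L_p(f, α)` for the rational `ϖ` with
`ϖ · Ω_E = Ω⁺_f`; as for the BCS fact, clause (2) is insensitive to `ϖ` (the exponent `k` absorbs
`p^{ord_p ϖ}`). Nothing is asserted: consumers take `(hYZ : thm49_charIdeal_eq_padicLFunction)`.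
-- TODO(general form): the second clause (equality in `Λ_ℚ` under (Im)) — for `p = 3` it is the
-- integral input of `thm415_padicValRat_bsd_rank_le_one_of_bigIm` (`YanZhu2026/PPartBSD.lean`).
[cite: YanZhu2024MainConjNonCM, Thm. 4.9 (§4.4, p. 11 of arXiv:2412.20078v2; = Thm. 5.2, §5.1 of v4 = J. Algebra 693 (2026)), with (4.8) (v4 Conj. 5.1) and Thm. 3.6 (§3.3)] -/
def thm49_charIdeal_eq_padicLFunction : Prop :=
  ∀ (W : WeierstrassCurve ℚ) [W.IsElliptic] [W.IsGloballyMinimal] (p : ℕ) [Fact p.Prime]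
    (κ : Literature.NumberTheory.EllipticCurves.ZpExtension ℚ p) (γ : Field.absoluteGaloisGroup ℚ)
    {N : ℕ} [NeZero N] (f : CuspForm (CongruenceSubgroup.Gamma0 N) 2)
    (_hp : 3 ≤ p) (_hgood : W.HasGoodReductionAtPrime p) (_hord : ¬ (p : ℤ) ∣ W.frobeniusTrace p)
    (_hirr : W.HasIrreducibleModPGaloisRep p) (_hκ : κ.IsCyclotomic) (_hγ : κ.IsTopGenerator γ)
    (_hγ' : Literature.NumberTheory.EllipticCurves.IsCyclotomicVariable p γ)
    (_hf : Literature.NumberTheory.EllipticCurves.ModularForms.IsNewformOf W f)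
    (D : W.SelmerDualData κ γ),
    D.IsTorsion ∧
      ∃ (g : Literature.NumberTheory.EllipticCurves.IwasawaAlgebra p) (k : ℤ),
        D.charIdeal = Ideal.span {g} ∧
          Literature.NumberTheory.EllipticCurves.iwasawaToPowerSeries p g =
            PowerSeries.C ((p : ℚ_[p]) ^ k) *
              Literature.NumberTheory.EllipticCurves.padicLFunction f
                (Literature.NumberTheory.EllipticCurves.unitRoot W p : ℚ_[p])

/-- At `p ≥ 5` the statement is the tree's BCS fact restricted: Theorem 4.9 implies
`burungale_castella_skinner_charIdeal_eq_padicLFunction` (same binders, `5 ≤ p ⇒ 3 ≤ p`).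
[cite: YanZhu2024MainConjNonCM, Thm. 4.9 (§4.4 of arXiv v2; v4 Thm. 5.2)] -/
theorem bcs_of_thm49 (h : thm49_charIdeal_eq_padicLFunction) :
    burungale_castella_skinner_charIdeal_eq_padicLFunction :=
  fun W _ _ p _ κ γ _ _ f hp hgood hord hirr hκ hγ hγ' hf D =>
    h W p κ γ f (by omega) hgood hord hirr hκ hγ hγ' hf D

end Literature.NumberTheory.EllipticCurves.YanZhu2026

end
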